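import Summits.QuantumFields.YangMills.Theorems.BalabanUVNodesK1EndCriterionCeilingFree
import Literature.MathematicalPhysics.QuantumFieldTheory.Balaban1983to89.Node00.Record13SepCoPHV

/-!
# K1⁹ `StabilityBRunRowsAtRecordR13SepCoPHV` (stmt-QuantumFields-27364, crux r3 DECIDING) — ITS ROW (iv) AND THE NO-SHRINK RUNG ARE STRICTLY STRONGER THAN THE END
# THEY SERVE: the top-run threshold (T) costs exactly a partial-sum floor ALONG TOP RUNS per level; a first-kick family has the END (exactly: (W), (T), (C) and
# `EndpointExistence (modelOf β)`) while rows (i), (iv) and no-(1+β₀)⁻¹-shrink FAIL at every level; at a box-ceiling witness the END of the (slot) datum is exactly (T)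

Cell `pub-ymgap`, WIDTH SEAT `pub-ymgap-dag-n13-w4` (gen 7).  `--kind proof --supports stmt-QuantumFields-27364 --as helper` (count-neutral; dag-lead KEY MAP v2).
PORT WITH ATTRIBUTION of ym-nodeO-ideate **P3 g54 evidence n°95** `run/shared/lean/pub/ym-nodeO-ideate/memos/lines/Rev29VEndExact-P3g54.lean` (HOME-only, farm rc 0,
sha256 e2413340c537c1f7…; evidence row n°4 on stmt-QuantumFields-27364) §9 `WhatTCosts` (:993, :1028), `EndExactRowStrict` (:1095–:1207, the family `betaFirstKick`) and
`SharpBillAtABoxCeiling` (:1068) — P3's mathematics and Lean text, this seat's adaptation: the planner's skeleton-local shapes `TopRunsAt` ∕ `RunwiseMulFloor` ∕ `RunwisePSFloor` are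
UNFOLDED to their verbatim bodies (as in this lineage's files 10–12), the family is NOT declared as a `def` but characterised by its two defining equations (`h0`, `h1`) with the
closed ∃-statement instantiating the lambda once, and §2 adds the construction-level conclusion `EndpointExistence (modelOf β)` (file 12's sufficiency road BY NAME) and the failure
of row (i).  [I] = [Balaban1987RG1] Commun. Math. Phys. **109** (1987); [III] = [Balaban1988Convergent] Commun. Math. Phys. **119** (1988).

WHY.  The deciding crux asks, at its witness, rows (i) run-wise constant remainder, (iv) run-wise partial-sum floor `−M` along ALL in-window (0.20)-runs, (C) survivor continuity; K2⁹
turns them into `EndpointExistence` at the slot datum.  This lineage's file 12 (`…K1EndCriterionCeilingFree`, p621368) showed END ⟺ {(W) all-K window runs, (T) per-level top-run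
thresholds} given (C) + non-crossing.  §1 prices (T): at one level `γ`, (T) ⟺ a partial-sum floor ALONG THE TOP RUNS OF LEVEL γ ONLY with a level-dependent constant (telescoped
(0.20)); so the pressed row (iv) gives (T) directly with `g⋆(γ) = (γ⁻² + M)^{-1∕2}`.  §2 is the separating witness: a history-dependent family whose only active step is the first
(`β 0 v = −1∕(v 0)³`, `β k ≡ 0` for `k ≥ 1`) sits under the ceiling `0`, is box-continuous (so (C)), has (W) and (T) at EVERY level and `EndpointExistence (modelOf β)` — while
no-(1+β₀)⁻¹-shrink fails at EVERY level for EVERY slack, the partial-sum floor fails at EVERY level for EVERY constant, and row (i) fails at EVERY level for EVERY reference sequence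
and radius.  So, AS LETTERS on a general `HBeta`, K1⁹'s rows (i)(iv) and the no-shrink rung (file 10) are STRICTLY above what the END reads (honest scope, P3's: the family is NOT
inside a two-sided (1.22) box — `β 0` is unbounded below; a separating family inside a box is located, not typed).  §3: at a box-CEILING witness (the K0-side letter of [I] (1.22)) the
END of the record datum — and of every slot datum, DEF-1's `toB12` face `rfl` — is EXACTLY (T), given (C) and non-crossing.

HONEST FRAMING: [folklore] real analysis on the (0.20)-recursion over the tree's carriers; every β-side letter is a HYPOTHESIS SHAPE; nothing of Bałaban asserted; nothing about
`Node00.betaOfRecord₁₃` proved; NO stub of the registered K1 v8 skeleton closed; K1⁹ ∕ K3⁸ ∕ K0⁷ OPEN; N13 NOT discharged; counts unmoved (typed 28∕28 · discharged 5∕27 · A 5∕28);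
[I] Thm 2 p.259 (first sentence) and (C) §1 pp.263–264 UNPROVED in print; one finite 𝕋⁴ programme at fixed `ε = L^{-K}`; R4 closes ONLY the CONDITIONAL finite-𝕋⁴ rung
`BalabanLadder.UV` — NOT continuum ∕ ℝ⁴ ∕ OS ∕ mass gap; the Yang–Mills mass gap (Clay) is NOT proved by any of this.  No `def`, no `instance`, no `notation`, no `axiom`.
-/

noncomputable section

namespace Summit.QuantumFields.YangMills.Theorems.BalabanUVNodesK1EndExactRowsStrict

open Literature.MathematicalPhysics.QuantumFieldTheory.Balaban1983to89
open Literature.MathematicalPhysics.QuantumFieldTheory.Balaban1983to89.FlowStep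
open Literature.MathematicalPhysics.QuantumFieldTheory.Balaban1983to89.FlowStepRuns
open Literature.MathematicalPhysics.QuantumFieldTheory.Balaban1983to89.DagBinding
open Literature.MathematicalPhysics.QuantumFieldTheory.Balaban1983to89.T4Continuum (T4Family FiniteEpsData)
open Summit.QuantumFields.YangMills.Theorems.BalabanUVNodesK2NamedJetsRunRemAt (Survivors SurvCont RunConstRemainder)
open Summit.QuantumFields.YangMills.Theorems.K1NodeOLadderRunwiseEdges (exists_noShrink_of_psFloor)
open Summit.QuantumFields.YangMills.Theorems.BalabanUVNodesK1WindowKOfRunRowsSurvivors (runwisePS_nonneg)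
open Summit.QuantumFields.YangMills.Theorems.BalabanUVNodesK1EndCriterionCeilingFree (endpointExistence_of_windowRuns_topRuns_betaContH
  endpointExistence_of_windowRuns_topRuns_survCont topRuns_of_endpointExistence windowRuns_of_betaUpperH haltsOutside_datumOfRecord₁₃SepCoPH
  endpointExistence_iff_windowRuns_topRuns)

/-! ## §1 What the threshold letter (T) costs at one level: a partial-sum floor along the top runs of that level -/

section WhatTCosts

variable {β : HBeta}

/-- **(T)(γ) ⟺ ROW (iv) ALONG THE TOP RUNS OF LEVEL γ, with a level-dependent constant** (`0 < γ`).  Telescoped (0.20) (`FlowStep.inv_sq_telescopeH`): on an in-]0,γ] solution with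
`g_k = γ`, `Σ_{j∈[k,n)} β_j = γ⁻² − g_n⁻²`; so a threshold `g_n ≥ g⋆` gives the floor `M := g⋆⁻²`, and a floor `M ≥ 0` gives the threshold `g⋆ := (γ⁻² + M)^{-1∕2}`.  (T) is the pressed
row (iv) (ONE `M` on ALL in-]0,γ₀] runs) RESTRICTED to top runs and DE-UNIFORMISED in the level — the exact floor-side price of the END.  ym-nodeO-ideate P3 g54 n°95 :993
`topRunThreshold_iff_topRunPSFloor`, PORTED WITH ATTRIBUTION (shape `TopRunsAt` unfolded). [cite: Balaban1987RG1, (0.20) p.256, Thm 2 p.259 (first sentence); Balaban1988Convergent, (2.6) p.255 (elementary)] -/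
theorem topRunThreshold_iff_topRunPSFloor (β : HBeta) {γ : ℝ} (hγ : 0 < γ) :
    (∃ gstar : ℝ, 0 < gstar ∧ ∀ (n : ℕ) (gs : ℕ → ℝ), RGEqH n β gs → Step.InInterval γ n gs → ∀ k, k ≤ n → gs k = γ → gstar ≤ gs n) ↔
    (∃ M : ℝ, 0 ≤ M ∧ ∀ (n : ℕ) (gs : ℕ → ℝ), RGEqH n β gs → Step.InInterval γ n gs → ∀ k, k ≤ n → gs k = γ →
      -M ≤ ∑ j ∈ Finset.Ico k n, β j (prefixOf gs j)) := by
  constructor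
  · rintro ⟨gstar, hgstar, H⟩
    refine ⟨1 / gstar ^ 2, by positivity, fun n gs hrg hI k hk hgk => ?_⟩
    have htel := inv_sq_telescopeH hrg hk le_rfl
    have hn : 0 < gs n := (hI n le_rfl).1
    have hle : gstar ≤ gs n := H n gs hrg hI k hk hgk
    have h1 : 1 / (gs n) ^ 2 ≤ 1 / gstar ^ 2 := one_div_le_one_div_of_le (by positivity) (pow_le_pow_left₀ hgstar.le hle 2)
    have h2 : 0 ≤ 1 / (gs k) ^ 2 := by positivity
    linarith
  · rintro ⟨M, hM, H⟩
    have hA : 0 < 1 / γ ^ 2 + M := by positivity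
    refine ⟨1 / Real.sqrt (1 / γ ^ 2 + M), by positivity, fun n gs hrg hI k hk hgk => ?_⟩
    have htel := inv_sq_telescopeH hrg hk le_rfl
    have hn : 0 < gs n := (hI n le_rfl).1
    have hfl : -M ≤ ∑ j ∈ Finset.Ico k n, β j (prefixOf gs j) := H n gs hrg hI k hk hgk
    rw [hgk] at htel
    have hinv : 1 / (gs n) ^ 2 ≤ 1 / γ ^ 2 + M := by linarith
    have hsq : 1 / (1 / γ ^ 2 + M) ≤ (gs n) ^ 2 := by
      rw [div_le_iff₀ hA]
      have := (div_le_iff₀ (by positivity : (0 : ℝ) < (gs n) ^ 2)).1 hinv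
      linarith
    have hs : (1 / Real.sqrt (1 / γ ^ 2 + M)) ^ 2 = 1 / (1 / γ ^ 2 + M) := by
      rw [div_pow, one_pow, Real.sq_sqrt hA.le]
    have hpos : 0 ≤ 1 / Real.sqrt (1 / γ ^ 2 + M) := by positivity
    nlinarith [hs, hsq, hn, hpos, sq_nonneg (gs n - 1 / Real.sqrt (1 / γ ^ 2 + M))]

/-- **THE PRESSED ROW (iv) GIVES (T) DIRECTLY AT EVERY LEVEL `γ ≤ γ₀`** (no detour through no-shrink): a run-wise partial-sum floor `−M ≤ Σ_{j∈[k,n)} β_j` on ALL in-]0,γ₀] solutions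
(`0 < γ₀`, so `0 ≤ M`: this lineage's `runwisePS_nonneg`) gives at every level `γ ∈ ]0, γ₀]` the threshold `g⋆(γ) = (γ⁻² + M)^{-1∕2}`.  (The no-shrink road of file 10 ∕ dag-n24-w1's
`exists_noShrink_of_psFloor` instead gives `γ″∕(1+β₀)` on a SHRUNK level; with file 12's `endpointExistence_of_windowRuns_topRuns_survCont` this re-derives file 11 §4's
`endpointExistence_of_windowRuns_runwisePS_survCont` — {(W), (iv), (C)} ⟹ END — on the SAME level, not restated.)  P3 g54 n°95 :1028, PORTED WITH ATTRIBUTION.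
[cite: Balaban1988Convergent, (2.6) p.255; Balaban1987RG1, (0.20) p.256, Thm 2 p.259 (first sentence) (elementary)] -/
theorem topRunThresholds_of_runwisePSFloor (β : HBeta) {γ₀ M : ℝ} (hγ₀ : 0 < γ₀)
    (hps : ∀ (n : ℕ) (gs : ℕ → ℝ), RGEqH n β gs → Step.InInterval γ₀ n gs → ∀ k, k ≤ n → -M ≤ ∑ j ∈ Finset.Ico k n, β j (prefixOf gs j)) :
    ∀ γ : ℝ, 0 < γ → γ ≤ γ₀ → ∃ gstar : ℝ, 0 < gstar ∧
      ∀ (n : ℕ) (gs : ℕ → ℝ), RGEqH n β gs → Step.InInterval γ n gs → ∀ k, k ≤ n → gs k = γ → gstar ≤ gs n :=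
  fun _ hγ hγle => (topRunThreshold_iff_topRunPSFloor β hγ).2
    ⟨M, runwisePS_nonneg hγ₀ hps, fun n gs hrg hI k hk _ => hps n gs hrg (fun i hi => ⟨(hI i hi).1, (hI i hi).2.trans hγle⟩) k hk⟩

end WhatTCosts

/-! ## §2 The first-kick family: the END holds (with (W), (T), (C) at every level) while rows (i), (iv) and no-shrink fail at every level -/

section FirstKick

variable {β : HBeta}

/-- **THE FIRST-KICK SHAPE** is read through its two defining equations: `h0 : β 0 v = −1∕(v 0)³` (only the first fluctuation step acts, by an anti-monotone kick unbounded below as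
`g_0 → 0⁺`) and `h1 : β k ≡ 0` for `k ≥ 1`.  First consequence: the family sits under the CEILING `0` on every box. P3 g54 n°95 :1104, PORTED WITH ATTRIBUTION. [folklore] -/
theorem firstKick_upper (h0 : ∀ v : Fin (0 + 1) → ℝ, β 0 v = -1 / (v 0) ^ 3) (h1 : ∀ k : ℕ, k ≠ 0 → ∀ v : Fin (k + 1) → ℝ, β k v = 0) (γ : ℝ) :
    BetaUpperH 0 γ β := by
  intro k v hv
  by_cases hk : k = 0
  · subst hk
    rw [h0]
    exact (div_neg_of_neg_of_pos (by norm_num) (pow_pos ((mem_box.mp hv) 0).1 3)).le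
  · exact (h1 k hk v).le

/-- the first-kick shape is box-continuous at every level ([I] §1 pp.263–264's letter). P3 g54 n°95 :1113, PORTED WITH ATTRIBUTION. [folklore] -/
theorem firstKick_cont (h0 : ∀ v : Fin (0 + 1) → ℝ, β 0 v = -1 / (v 0) ^ 3) (h1 : ∀ k : ℕ, k ≠ 0 → ∀ v : Fin (k + 1) → ℝ, β k v = 0) (γ : ℝ) :
    BetaContH γ β := by
  intro k
  by_cases hk : k = 0
  · subst hk
    have hc : ContinuousOn (fun v : Fin (0 + 1) → ℝ => -1 / (v 0) ^ 3) (Box γ 0) :=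
      continuousOn_const.div ((continuous_apply 0).pow 3).continuousOn fun v hv => (pow_pos ((mem_box.mp hv) 0).1 3).ne'
    exact hc.congr fun v _ => h0 v
  · exact continuousOn_const.congr fun v _ => h1 k hk v

/-- hence run-wise (C) `SurvCont` at every level `γ₀ > 0` (DEF-1's letter; `SurvCont.of_betaContH`). P3 g54 n°95 :1123, PORTED WITH ATTRIBUTION. [folklore] -/
theorem firstKick_survCont (h0 : ∀ v : Fin (0 + 1) → ℝ, β 0 v = -1 / (v 0) ^ 3) (h1 : ∀ k : ℕ, k ≠ 0 → ∀ v : Fin (k + 1) → ℝ, β k v = 0) {γ₀ : ℝ} (hγ₀ : 0 < γ₀) :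
    SurvCont β γ₀ :=
  SurvCont.of_betaContH hγ₀ (firstKick_cont h0 h1 γ₀)

/-- (W) for the first-kick shape: runs of every length in every window (automatic under a ceiling: file 12's `windowRuns_of_betaUpperH`). P3 g54 n°95 :1127, PORTED WITH ATTRIBUTION. [folklore] -/
theorem firstKick_windowRuns (h0 : ∀ v : Fin (0 + 1) → ℝ, β 0 v = -1 / (v 0) ^ 3) (h1 : ∀ k : ℕ, k ≠ 0 → ∀ v : Fin (k + 1) → ℝ, β k v = 0) (γ₀ : ℝ) :
    ∀ γ : ℝ, 0 < γ → γ ≤ γ₀ → ∀ K : ℕ, ∃ gs : ℕ → ℝ, RGEqH K β gs ∧ Step.InInterval γ K gs :=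
  windowRuns_of_betaUpperH (firstKick_upper h0 h1 γ₀)

/-- partial sums of the first-kick shape along any sequence, away from the first step: zero. P3 g54 n°95 :1132, PORTED WITH ATTRIBUTION. [folklore] -/
theorem sum_firstKick_Ico_of_ne_zero (h1 : ∀ k : ℕ, k ≠ 0 → ∀ v : Fin (k + 1) → ℝ, β k v = 0) (gs : ℕ → ℝ) {k n : ℕ} (hk : k ≠ 0) :
    ∑ j ∈ Finset.Ico k n, β j (prefixOf gs j) = 0 :=
  Finset.sum_eq_zero fun j hj => h1 j (by have := (Finset.mem_Ico.mp hj).1; omega) _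

/-- … and from the first step: exactly the one kick `−1∕g_0³`. P3 g54 n°95 :1137, PORTED WITH ATTRIBUTION. [folklore] -/
theorem sum_firstKick_Ico_zero (h0 : ∀ v : Fin (0 + 1) → ℝ, β 0 v = -1 / (v 0) ^ 3) (h1 : ∀ k : ℕ, k ≠ 0 → ∀ v : Fin (k + 1) → ℝ, β k v = 0)
    (gs : ℕ → ℝ) {n : ℕ} (hn : 0 < n) :
    ∑ j ∈ Finset.Ico 0 n, β j (prefixOf gs j) = -1 / (gs 0) ^ 3 := by
  rw [Finset.sum_eq_sum_Ico_succ_bot hn, zero_add, sum_firstKick_Ico_of_ne_zero h1 gs one_ne_zero, add_zero, h0]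
  simp [prefixOf_apply]

/-- **(T) AT EVERY LEVEL for the first-kick shape** — via `topRunThreshold_iff_topRunPSFloor` with the level-dependent constant `M(γ) = γ⁻³` (a top run of level `γ` is kicked by exactly
`γ⁻³` in `g⁻²`, or not at all). P3 g54 n°95 :1144, PORTED WITH ATTRIBUTION. [folklore] -/
theorem firstKick_topRuns (h0 : ∀ v : Fin (0 + 1) → ℝ, β 0 v = -1 / (v 0) ^ 3) (h1 : ∀ k : ℕ, k ≠ 0 → ∀ v : Fin (k + 1) → ℝ, β k v = 0) {γ : ℝ} (hγ : 0 < γ) :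
    ∃ gstar : ℝ, 0 < gstar ∧ ∀ (n : ℕ) (gs : ℕ → ℝ), RGEqH n β gs → Step.InInterval γ n gs → ∀ k, k ≤ n → gs k = γ → gstar ≤ gs n :=
  (topRunThreshold_iff_topRunPSFloor β hγ).2 ⟨1 / γ ^ 3, by positivity, fun n gs _ _ k hk hgk => by
    by_cases hk0 : k = 0
    · subst hk0
      rcases Nat.eq_zero_or_pos n with rfl | hn
      · simp only [Finset.Ico_self, Finset.sum_empty]; exact neg_nonpos.mpr (by positivity)
      · rw [sum_firstKick_Ico_zero h0 h1 gs hn, hgk, neg_div]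
    · rw [sum_firstKick_Ico_of_ne_zero h1 gs hk0]; exact neg_nonpos.mpr (by positivity)⟩

/-- ★ **THE FIRST-KICK SHAPE'S MODEL CONSTRUCTION HAS THE END**: `EndpointExistence (modelOf β)` — (W) and (T) at every level plus box continuity, through file 12's ceiling-free, floor-free
sufficiency road `endpointExistence_of_windowRuns_topRuns_betaContH` at the canonical construction `modelOf β` (forward-generated by construction).  This is what the pressed rows are FOR;
the next theorems show the pressed rows themselves FAIL for this shape. [cite: Balaban1987RG1, Thm 2 p.259 (first sentence), (0.17)–(0.20) pp.255–256 (elementary; nothing of the theorem asserted)] -/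
theorem endpointExistence_modelOf_firstKick (h0 : ∀ v : Fin (0 + 1) → ℝ, β 0 v = -1 / (v 0) ^ 3) (h1 : ∀ k : ℕ, k ≠ 0 → ∀ v : Fin (k + 1) → ℝ, β k v = 0) :
    EndpointExistence (modelOf β) :=
  endpointExistence_of_windowRuns_topRuns_betaContH (modelOf_forwardGenerated β) (γ₀ := 1) (γ' := 1) one_pos le_rfl (firstKick_cont h0 h1 1)
    (firstKick_windowRuns h0 h1 1) (fun _ hγ _ => firstKick_topRuns h0 h1 hγ)

/-- **NO-(1+β₀)⁻¹-SHRINK FAILS AT EVERY LEVEL FOR EVERY SLACK** for the first-kick shape: the window run of length `1` from `g_0 = a ≤ ε := min γ (1∕(2(1+β₀)²))` ends at `g_1` with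
`g_1² ≤ a³`, so `a ≤ (1+β₀)·g_1` would force `(1+β₀)²·a ≥ 1`.  (Shape `RunwiseMulFloor` of the planner memo unfolded; = the last member of [III] (2.6) along runs.)  P3 g54 n°95 :1155,
PORTED WITH ATTRIBUTION. [cite: Balaban1988Convergent, (2.6) p.255 (the letter only; elementary)] -/
theorem firstKick_not_noShrink (h0 : ∀ v : Fin (0 + 1) → ℝ, β 0 v = -1 / (v 0) ^ 3) (h1 : ∀ k : ℕ, k ≠ 0 → ∀ v : Fin (k + 1) → ℝ, β k v = 0)
    {γ β₀ : ℝ} (hγ : 0 < γ) (hβ₀ : 0 ≤ β₀) :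
    ¬ ∀ (n : ℕ) (gs : ℕ → ℝ), RGEqH n β gs → Step.InInterval γ n gs → ∀ m n', m < n' → n' ≤ n → gs m ≤ (1 + β₀) * gs n' := by
  intro hns
  have hc : (0 : ℝ) < (1 + β₀) ^ 2 := by positivity
  obtain ⟨ε, hε, hεγ, hεc⟩ : ∃ ε : ℝ, 0 < ε ∧ ε ≤ γ ∧ ε ≤ 1 / (2 * (1 + β₀) ^ 2) :=
    ⟨min γ (1 / (2 * (1 + β₀) ^ 2)), lt_min hγ (by positivity), min_le_left _ _, min_le_right _ _⟩
  obtain ⟨gs, hrg, hI⟩ := firstKick_windowRuns h0 h1 ε ε hε le_rfl 1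
  have ha : 0 < gs 0 := (hI 0 (Nat.zero_le 1)).1
  have haε : gs 0 ≤ ε := (hI 0 (Nat.zero_le 1)).2
  have hb : 0 < gs 1 := (hI 1 le_rfl).1
  have hstep : 1 / (gs 0) ^ 2 = 1 / (gs 1) ^ 2 + -1 / (gs 0) ^ 3 := by
    simpa [prefixOf_apply, h0] using hrg 0 Nat.one_pos
  have hle : gs 0 ≤ (1 + β₀) * gs 1 :=
    hns 1 gs hrg (fun i hi => ⟨(hI i hi).1, (hI i hi).2.trans hεγ⟩) 0 1 Nat.one_pos le_rfl
  have h13 : 1 / (gs 0) ^ 3 ≤ 1 / (gs 1) ^ 2 := by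
    have : 0 < 1 / (gs 0) ^ 2 := by positivity
    rw [neg_div] at hstep
    linarith
  have hb2 : (gs 1) ^ 2 ≤ (gs 0) ^ 3 := (one_div_le_one_div (by positivity) (by positivity)).1 h13
  have key : 1 ≤ (1 + β₀) ^ 2 * gs 0 := by
    by_contra hlt
    rw [not_le] at hlt
    have hA : (1 + β₀) ^ 2 * (gs 0) ^ 3 < (gs 0) ^ 2 := by
      calc (1 + β₀) ^ 2 * (gs 0) ^ 3 = ((1 + β₀) ^ 2 * gs 0) * (gs 0) ^ 2 := by ring
        _ < 1 * (gs 0) ^ 2 := mul_lt_mul_of_pos_right hlt (by positivity)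
        _ = (gs 0) ^ 2 := one_mul _
    have hB : (1 + β₀) ^ 2 * (gs 1) ^ 2 ≤ (1 + β₀) ^ 2 * (gs 0) ^ 3 := mul_le_mul_of_nonneg_left hb2 hc.le
    have hC : (gs 0) ^ 2 ≤ (1 + β₀) ^ 2 * (gs 1) ^ 2 := by
      rw [← mul_pow]; exact pow_le_pow_left₀ ha.le hle 2
    linarith
  have hhalf : (1 + β₀) ^ 2 * gs 0 ≤ 1 / 2 :=
    calc (1 + β₀) ^ 2 * gs 0 ≤ (1 + β₀) ^ 2 * (1 / (2 * (1 + β₀) ^ 2)) := mul_le_mul_of_nonneg_left (haε.trans hεc) hc.le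
      _ = 1 / 2 := by field_simp
  linarith

/-- **ROW (iv) — THE RUN-WISE PARTIAL-SUM FLOOR — FAILS AT EVERY LEVEL FOR EVERY CONSTANT** for the first-kick shape: contrapositive of the TREE's edge «(PS) floor ⟹ no-shrink on a shrunk
level, every slack» (dag-n24-w1 `K1NodeOLadderRunwiseEdges.exists_noShrink_of_psFloor`, slack `1`) and `firstKick_not_noShrink`.  P3 g54 n°95 :1191, PORTED WITH ATTRIBUTION. [cite: Balaban1987RG1, (0.20) p.256; Balaban1988Convergent, (2.6) p.255 (elementary)] -/
theorem firstKick_not_psFloor (h0 : ∀ v : Fin (0 + 1) → ℝ, β 0 v = -1 / (v 0) ^ 3) (h1 : ∀ k : ℕ, k ≠ 0 → ∀ v : Fin (k + 1) → ℝ, β k v = 0)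
    {γ : ℝ} (hγ : 0 < γ) (M : ℝ) :
    ¬ ∀ (n : ℕ) (gs : ℕ → ℝ), RGEqH n β gs → Step.InInterval γ n gs → ∀ k, k ≤ n → -M ≤ ∑ j ∈ Finset.Ico k n, β j (prefixOf gs j) := by
  intro hps
  obtain ⟨γ', hγ', -, hmul⟩ := exists_noShrink_of_psFloor (β := β) one_pos hγ hps
  exact firstKick_not_noShrink h0 h1 hγ' zero_le_one hmul

/-- **ROW (i) — THE RUN-WISE CONSTANT REMAINDER — FAILS AT EVERY LEVEL FOR EVERY REFERENCE SEQUENCE AND RADIUS** for the first-kick shape: at the one-point run `(a)` of level `γ` (an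
(0.20)-solution up to `0`), `|β 0 (a) − b 0| = |a⁻³ + b 0| ≥ a⁻³ − |b 0| > r` once `a ≤ min 1 (|b 0| + r + 1)⁻¹` (then `a⁻³ ≥ a⁻¹`).  So the first-kick shape violates BOTH pressed rows
and has the END. [folklore] -/
theorem firstKick_not_runConstRemainder (h0 : ∀ v : Fin (0 + 1) → ℝ, β 0 v = -1 / (v 0) ^ 3) {γ : ℝ} (hγ : 0 < γ) (b : ℕ → ℝ) (r : ℝ) :
    ¬ RunConstRemainder β b r γ := by
  intro hrem
  set c : ℝ := |b 0| + r + 1 with hc_def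
  by_cases hr : r < 0
  · -- a negative radius is refuted by any run
    have h := hrem 0 (fun _ => γ) (fun k hk => absurd hk (Nat.not_lt_zero k)) (fun _ _ => ⟨hγ, le_rfl⟩) 0 le_rfl
    linarith [abs_nonneg (β 0 (prefixOf (fun _ => γ) 0) - b 0)]
  rw [not_lt] at hr
  have hc : 0 < c := by rw [hc_def]; positivity
  set a : ℝ := min γ (min 1 (1 / c)) with ha_def
  have ha : 0 < a := lt_min hγ (lt_min one_pos (by positivity))
  have haγ : a ≤ γ := min_le_left _ _
  have ha1 : a ≤ 1 := (min_le_right _ _).trans (min_le_left _ _)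
  have hac : a ≤ 1 / c := (min_le_right _ _).trans (min_le_right _ _)
  have hRG : RGEqH 0 β (fun _ => a) := fun k hk => absurd hk (Nat.not_lt_zero k)
  have hI : Step.InInterval a 0 (fun _ => a) := fun _ _ => ⟨ha, le_rfl⟩
  have h := hrem.mono haγ 0 (fun _ => a) hRG hI 0 le_rfl
  have hβ : β 0 (prefixOf (fun _ => a) 0) = -1 / a ^ 3 := by rw [h0]; simp [prefixOf_apply]
  rw [hβ] at h
  -- `a⁻³ ≥ a⁻¹ ≥ c`
  have h3 : 1 / a ≤ 1 / a ^ 3 := by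
    rw [div_le_div_iff₀ ha (by positivity), one_mul, one_mul]
    calc a ^ 3 = a * a * a := by ring
      _ ≤ 1 * 1 * a := by gcongr
      _ = a := by ring
  have hca : c ≤ 1 / a := by
    rw [le_div_iff₀ ha]
    calc c * a ≤ c * (1 / c) := mul_le_mul_of_nonneg_left hac hc.le
      _ = 1 := by field_simp
  have habs : 1 / a ^ 3 - |b 0| ≤ |-1 / a ^ 3 - b 0| := by
    have e : -1 / a ^ 3 - b 0 = -(1 / a ^ 3 + b 0) := by ring
    rw [e, abs_neg]
    have := abs_add_le (1 / a ^ 3 + b 0) (-(b 0))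
    rw [add_neg_cancel_right, abs_neg] at this
    have h' : |1 / a ^ 3| = 1 / a ^ 3 := abs_of_pos (by positivity)
    linarith
  have : c ≤ |b 0| + r := by linarith
  rw [hc_def] at this
  linarith

/-- ★★ **THE END-EXACT LETTERS ARE STRICTLY BELOW THE PRESSED ROWS AND THE NO-SHRINK RUNG — KERNEL WITNESS.**  One history-dependent family `β` (the first-kick shape, instantiated here
once) carrying the CEILING `0` on every box, box-continuity at every level, run-wise (C) at every level, (W) runs of every length in every window, (T) a top-run threshold at every level,
and `EndpointExistence (modelOf β)` — for which NO-(1+β₀)⁻¹-SHRINK fails at EVERY level for EVERY slack `β₀ ≥ 0`, the PARTIAL-SUM FLOOR (row (iv)) fails at EVERY level for EVERY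
constant, and the RUN-WISE CONSTANT REMAINDER (row (i)) fails at EVERY level for EVERY `(b, r)`.  So, as LETTERS on a general `HBeta`, what K2⁹'s END reads ({(W), (T), (C)}, file 12) is
STRICTLY WEAKER than K1⁹'s pressed rows {(i), (iv), (C)} and than file 10's no-shrink rung — even under a ceiling; the rungs do not reverse by bookkeeping.  HONEST SCOPE (P3's): the
family is NOT inside a two-sided (1.22) box (`β 0` unbounded below); at the route's `betaOfRecord₁₃ θ` NOTHING is claimed.  P3 g54 n°95 :1199 `endExactLetters_strictly_below_noShrink_and_psFloor`,
PORTED WITH ATTRIBUTION and extended by the END conclusion and the row-(i) failure. [folklore] -/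
theorem endExactLetters_strictly_below_pressedRows : ∃ β : HBeta,
    (∀ γ : ℝ, BetaUpperH 0 γ β) ∧ (∀ γ : ℝ, BetaContH γ β) ∧ (∀ γ₀ : ℝ, 0 < γ₀ → SurvCont β γ₀) ∧
    (∀ γ : ℝ, 0 < γ → ∀ K : ℕ, ∃ gs : ℕ → ℝ, RGEqH K β gs ∧ Step.InInterval γ K gs) ∧
    (∀ γ : ℝ, 0 < γ → ∃ gstar : ℝ, 0 < gstar ∧
      ∀ (n : ℕ) (gs : ℕ → ℝ), RGEqH n β gs → Step.InInterval γ n gs → ∀ k, k ≤ n → gs k = γ → gstar ≤ gs n) ∧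
    EndpointExistence (modelOf β) ∧
    (∀ γ β₀ : ℝ, 0 < γ → 0 ≤ β₀ →
      ¬ ∀ (n : ℕ) (gs : ℕ → ℝ), RGEqH n β gs → Step.InInterval γ n gs → ∀ m n', m < n' → n' ≤ n → gs m ≤ (1 + β₀) * gs n') ∧
    (∀ γ M : ℝ, 0 < γ →
      ¬ ∀ (n : ℕ) (gs : ℕ → ℝ), RGEqH n β gs → Step.InInterval γ n gs → ∀ k, k ≤ n → -M ≤ ∑ j ∈ Finset.Ico k n, β j (prefixOf gs j)) ∧
    (∀ γ : ℝ, 0 < γ → ∀ (b : ℕ → ℝ) (r : ℝ), ¬ RunConstRemainder β b r γ) := by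
  have h0 : ∀ v : Fin (0 + 1) → ℝ, (fun k w => if k = 0 then -1 / (w 0) ^ 3 else 0 : HBeta) 0 v = -1 / (v 0) ^ 3 := fun v => if_pos rfl
  have h1 : ∀ k : ℕ, k ≠ 0 → ∀ v : Fin (k + 1) → ℝ, (fun k w => if k = 0 then -1 / (w 0) ^ 3 else 0 : HBeta) k v = 0 := fun k hk v => if_neg hk
  exact ⟨fun k w => if k = 0 then -1 / (w 0) ^ 3 else 0, firstKick_upper h0 h1, firstKick_cont h0 h1, fun _ hγ₀ => firstKick_survCont h0 h1 hγ₀,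
    fun γ hγ => firstKick_windowRuns h0 h1 γ γ hγ le_rfl, fun _ hγ => firstKick_topRuns h0 h1 hγ, endpointExistence_modelOf_firstKick h0 h1,
    fun _ _ hγ hβ₀ => firstKick_not_noShrink h0 h1 hγ hβ₀, fun _ M hγ => firstKick_not_psFloor h0 h1 hγ M,
    fun _ hγ b r => firstKick_not_runConstRemainder h0 hγ b r⟩

/-- **COROLLARY — THE END DOES NOT PAY K1⁹'s ROWS, AT CONSTRUCTION LEVEL**: there is a forward-generated, halting, currying construction WITH `EndpointExistence` (K2⁹'s consequent shape) and
box-continuous β (so (C) at every level) whose β has NEITHER row (i) NOR row (iv) at ANY level — the converse of K2⁹'s implication fails as letters. [folklore] -/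
theorem exists_endpointExistence_without_rows : ∃ β : HBeta,
    EndpointExistence (modelOf β) ∧ (∀ γ : ℝ, BetaContH γ β) ∧
    (∀ γ : ℝ, 0 < γ → ∀ (b : ℕ → ℝ) (r : ℝ), ¬ RunConstRemainder β b r γ) ∧
    (∀ γ M : ℝ, 0 < γ →
      ¬ ∀ (n : ℕ) (gs : ℕ → ℝ), RGEqH n β gs → Step.InInterval γ n gs → ∀ k, k ≤ n → -M ≤ ∑ j ∈ Finset.Ico k n, β j (prefixOf gs j)) := by
  obtain ⟨β, -, hcont, -, -, -, hE, -, hps, hrem⟩ := endExactLetters_strictly_below_pressedRows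
  exact ⟨β, hE, hcont, hrem, hps⟩

end FirstKick

/-! ## §3 At a box-ceiling witness the END of the (slot) datum is exactly (T) (general `N`) -/

section CeilingWitness

variable {F : T4Family} {N : ℕ} [NeZero N]

/-- **★ AT A BOX-CEILING WITNESS THE END OF THE RECORD IS EXACTLY (T)** (general `N`): given the ceiling `β_θ ≤ β′` on `]0,γ₀]^{k+1}` (the K0-side letter of [I] Thm 3 (1.22)), survivor
continuity (C) at `γ₀` and non-crossing below `γ₀` (NODE O's letters, not asserted), `EndpointExistence (datumOfRecord₁₃SepCoPH F N θ h).C.toB12 ↔ ∃ γ₂ > 0, (T) on ]0,γ₂]` — (W) is automatic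
from the ceiling (`windowRuns_of_betaUpperH`); file 12's criterion at the datum with `SurvCont` in place of box continuity.  So at such a witness NODE O's END bill is EXACTLY {(T), (C)}
modulo non-crossing — by §1, (PS) along top runs per level instead of (PS) along all runs with one constant.  P3 g54 n°95 :1068, PORTED WITH ATTRIBUTION.
[cite: Balaban1987RG1, Thm 2 p.259 (first sentence), §1 (1.22) p.264, (0.17)–(0.20) pp.255–256, §1 pp.263–264 (bookkeeping + elementary)] -/
theorem endpointExistence_datumOfRecord₁₃SepCoPH_iff_topRuns_of_betaUpperH (θ : Node00.Stage13HParams F N) (h : θ.Provisos₁₃SepCoPH F N) {β' γ₀ : ℝ} (hγ₀ : 0 < γ₀)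
    (hhi : BetaUpperH β' γ₀ (Node00.betaOfRecord₁₃ F N θ.toStage13Params))
    (hsc : SurvCont (Node00.betaOfRecord₁₃ F N θ.toStage13Params) γ₀)
    (hord : ∀ γ : ℝ, 0 < γ → γ ≤ γ₀ → ∀ (n : ℕ) (gs gs' : ℕ → ℝ), RGEqH n (Node00.betaOfRecord₁₃ F N θ.toStage13Params) gs →
      RGEqH n (Node00.betaOfRecord₁₃ F N θ.toStage13Params) gs' → Step.InInterval γ n gs → Step.InInterval γ n gs' → gs 0 < gs' 0 → ∀ k, k ≤ n → gs k < gs' k) :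
    EndpointExistence (Node00.datumOfRecord₁₃SepCoPH F N θ h).C.toB12 ↔
      ∃ γ₂ : ℝ, 0 < γ₂ ∧ ∀ γ : ℝ, 0 < γ → γ ≤ γ₂ → ∃ gstar : ℝ, 0 < gstar ∧
        ∀ (n : ℕ) (gs : ℕ → ℝ), RGEqH n (Node00.betaOfRecord₁₃ F N θ.toStage13Params) gs → Step.InInterval γ n gs → ∀ k, k ≤ n → gs k = γ → gstar ≤ gs n := by
  constructor
  · intro hE
    obtain ⟨γt, hγt, Ht⟩ := topRuns_of_endpointExistence (Node00.datumOfRecord₁₃SepCoPH F N θ h).fwd (haltsOutside_datumOfRecord₁₃SepCoPH θ h)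
      (Node00.datumOfRecord₁₃SepCoPH F N θ h).curries hγ₀ hord hE
    exact ⟨γt, hγt, Ht⟩
  · rintro ⟨γ₂, hγ₂, H⟩
    have hγ₁ : 0 < min γ₂ γ₀ := lt_min hγ₂ hγ₀
    exact endpointExistence_of_windowRuns_topRuns_survCont (Node00.datumOfRecord₁₃SepCoPH F N θ h).fwd hγ₀ hγ₁ (min_le_right _ _)
      (windowRuns_of_betaUpperH hhi) (fun γ hγ hγle => H γ hγ (hγle.trans (min_le_left _ _))) hsc

/-- **… AND AT EVERY SLOT DATUM** `datumOfRecord₁₃SepCoPHV F N θ h v` (route rev 28∕29): the END is version-free (DEF-1's `toB12` face, `rfl`), so the box-ceiling witness's END bill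
{(T), (C)} transfers to every revision `v` verbatim. [cite: Balaban1987RG1, Thm 2 p.259 (first sentence), §1 (1.22) p.264, (0.17)–(0.20) pp.255–256 (bookkeeping)] -/
theorem endpointExistence_datumOfRecord₁₃SepCoPHV_iff_topRuns_of_betaUpperH (θ : Node00.Stage13HParams F N) (h : θ.Provisos₁₃SepCoPH F N)
    (v : Node00.Revision₁₃ F N θ h) {β' γ₀ : ℝ} (hγ₀ : 0 < γ₀)
    (hhi : BetaUpperH β' γ₀ (Node00.betaOfRecord₁₃ F N θ.toStage13Params))
    (hsc : SurvCont (Node00.betaOfRecord₁₃ F N θ.toStage13Params) γ₀)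
    (hord : ∀ γ : ℝ, 0 < γ → γ ≤ γ₀ → ∀ (n : ℕ) (gs gs' : ℕ → ℝ), RGEqH n (Node00.betaOfRecord₁₃ F N θ.toStage13Params) gs →
      RGEqH n (Node00.betaOfRecord₁₃ F N θ.toStage13Params) gs' → Step.InInterval γ n gs → Step.InInterval γ n gs' → gs 0 < gs' 0 → ∀ k, k ≤ n → gs k < gs' k) :
    EndpointExistence (Node00.datumOfRecord₁₃SepCoPHV F N θ h v).C.toB12 ↔
      ∃ γ₂ : ℝ, 0 < γ₂ ∧ ∀ γ : ℝ, 0 < γ → γ ≤ γ₂ → ∃ gstar : ℝ, 0 < gstar ∧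
        ∀ (n : ℕ) (gs : ℕ → ℝ), RGEqH n (Node00.betaOfRecord₁₃ F N θ.toStage13Params) gs → Step.InInterval γ n gs → ∀ k, k ≤ n → gs k = γ → gstar ≤ gs n := by
  rw [Node00.toB12_datumOfRecord₁₃SepCoPHV]
  exact endpointExistence_datumOfRecord₁₃SepCoPH_iff_topRuns_of_betaUpperH θ h hγ₀ hhi hsc hord

end CeilingWitness

end Summit.QuantumFields.YangMills.Theorems.BalabanUVNodesK1EndExactRowsStrict

end
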